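import Literature.MathematicalPhysics.QuantumFieldTheory.Balaban1983to89.B9PinCarriersKLevelV1P
import Literature.MathematicalPhysics.QuantumFieldTheory.Balaban1983to89.B9BackgroundsKLevelV1R

/-!
# `Balaban1983to89.B9PinCarriersKLevelV1R` — Stage-3′(Y) GEOMETRY∕INDEX layer, MODULE 5-R: the [B9] carrier bundle `carriersYR R₁ R₂ ops : DagBinding.PrintedCarriers9X`
# over the CLASS-PARAMETRIC background carrier `bg9YR R₁ R₂` (MODULE 3-R `B9BackgroundsKLevelV1R`), as a function of the SAME operator layer `OperatorLayerY` (MODULE 5);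
# its two readings `carriersY` (MODULE 5, `rfl`) and `carriersYP` (MODULE 5-P = print's class, `rfl`); the N06 knit at this bundle

B9 = T. Bałaban, *Propagators for lattice gauge theories in a background field*, Commun. Math. Phys. **99** (1985) 389–434 [Balaban1985BackgroundPropagators].
pub-ymgap Track A, node N06 = `Dag.B9_main`; seat `pub-ymgap-node00-def-Y` g7 (OWNER of the `OpsY` instance at the record); plan of record dag-lead CASCADE-R.
APPEND-ONLY companion of MODULE 5 `B9PinCarriersKLevelV1` and MODULE 5-P `B9PinCarriersKLevelV1P` (both untouched, consumed by name).  DEFINITIONS + knit theorem;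
nothing of [B9] asserted; count-neutral; N06 NOT discharged.

ONE CARRIER, EVERY CLASS.  MODULE 3-R types the member background carrier once over a parameter `(R₁, R₂)` of regularity-predicate families, with
`bg9Y 𝔸 G x = bg9YR 𝔸 G (regY335 𝔸 G) (regY336 𝔸 G) x` and `bg9YP 𝔸 G x = bg9YR 𝔸 G (regYP335 𝔸 G) (regYP336 𝔸 G) x` by `rfl`.  This file carries the parameter
through MODULE 5-P verbatim: **`carriersYR 𝔸 G R₁ R₂ ops`** is `carriersYP` with `bg9 := bg9YR 𝔸 G R₁ R₂` and the R-generic re-typings of MODULE 3-R §1, over the SAME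
operator layer type `OperatorLayerY` (so NODE 00's instance of record plugs in UNCHANGED), and
**`carriersY … ops = carriersYR … (regY335 𝔸 G) (regY336 𝔸 G) ops`**, **`carriersYP … ops = carriersYR … (regYP335 𝔸 G) (regYP336 𝔸 G) ops`** hold by `rfl`
(structure eta on the records).  Hence the N06 target `B9LeafX` and every displayed binder of the knit, typed ONCE at generic `(R₁, R₂)`, READ at MODULE 3's class
and at print's class by `Iff.rfl` ∕ `exact` — dag-n06-d's certificate edition 8 is pressed once at `carriersYR` and specialised, not re-pressed per class.

WHAT IS DEFINED ∕ PROVED.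
* §1 `kernelFamilyR_regYP`, `siteKernelR_regYP`, `hKernelR_regYP`: at print's families the R-generic re-typings ARE MODULE 5-P's (`rfl`).
* §2 **`carriersYR 𝔸 G R₁ R₂ ops : PrintedCarriers9X`**; field lemmas (`rfl`); the two readings **`carriersY_eq_carriersYR`**, **`carriersYP_eq_carriersYR`** (`rfl`) and
  `b9LeafX_carriersY_iff`, `b9LeafX_carriersYP_iff` (`Iff.rfl`).
* §3 **THE KNIT AT `carriersYR`**: `b9LeafX_carriersYR` = `B9LeafKnitOn.b9LeafX_of_b6BlockParam_on` at `Y := carriersYR 𝔸 G R₁ R₂ ops`, NODE 00's tower block of record,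
  `ι x := ⟨x.toKIdx, x.hcfk⟩`, `hd := rfl`, `hc := c35Y_pos`, `S := modelSignsOn_geo9K`, `Dict := dictAtOneY`; the class being a parameter, the `U ≡ 1` membership
  **`hone : ∀ x α₀, 0 < α₀ → R₁ x c35Y α₀ 1` is DISPLAYED** (discharged at the readings by MODULE 3-R's `regY335_one x c35Y_pos` ∕ `regYP335_one x c35Y`); the `U = 1`
  operator comparisons and null readings VERBATIM MODULE 5's; the residual entries, Sect. B step, gauge reduction and sixteen leaves OVER `bg9YR 𝔸 G R₁ R₂`.
* §4 guards `carriersYR_nonempty_I9 ∕ _unbounded_M ∕ _exists_nonempty_Λ ∕ _cor36_vacuous` (class-independent facts of MODULE 3 ∕ MODULE 4).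
CONSUMERS (pub-ymgap bus, dag-lead CASCADE-R): dag-n06-d's successor — certificate EDITION 8 at `carriersYR` (U = 1 binders verbatim; leaf ∕ residual binders with
`bg9Y ↦ bg9YR 𝔸 G R₁ R₂`, `(ops x).K ↦ kernelFamilyR R₁ R₂ (ops x).K`, `hone` from the coverage side at print's class); node00-def-K0a — `Y9OfRecordR N θ M⋆ R₁ R₂ ops :=
carriersYR … R₁ R₂ ops` beside `Y9OfRecord` ∕ `Y9OfRecordP` if wanted (same `OpsY` slot).
HONEST SCOPE: the operator layer and the class are PARAMETERS; no estimate; one finite lattice programme; NOT continuum ∕ OS ∕ mass gap ∕ Clay.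
No `sorry`, no `axiom`, no `instance`, no `notation`.
-/

noncomputable section

namespace Literature.MathematicalPhysics.QuantumFieldTheory.Balaban1983to89.B9PinCarriersKLevelV1R

open DagBinding
open B6KLevelCensusIndexV1 (KIdx)
open B9PinMembersKLevelV1 (MemberY geo9Y bg9Y)
open B9BackgroundsKLevelV1P (bg9YP)
open B9BackgroundsKLevelV1R (RegFamY bg9YR regY335 regY336 regYP335 regYP336 kernelFamilyR kernelFamilyRY siteKernelR fineKernelR rwExpansionR
  rwKernelExpansionR hKernelR hKernelRY)
open B9PinGeometryKLevelV1 (dOmegaY OmKY inΛY unitDistY InCubeY c35Y c35Y_pos dictAtOneY)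
open B9PinCarriersKLevelV1 (OperatorLayerY carriersY)
open B9PinCarriersKLevelV1P (carriersYP)
open B9FromB6ModelSignsOn (ModelSignsOn)

variable {d ℓ : ℕ} {hd : 1 ≤ d + 1} {hL : Odd (ℓ + 1) ∧ 1 < ℓ + 1} {b₀ b₁ : ℝ} {Mstar : ℕ}
variable {𝔸 : Type} [NormedRing 𝔸] [NormedAlgebra ℂ 𝔸] [CompleteSpace 𝔸] {G : Subgroup 𝔸ˣ}

/-! ## §1 The R-generic re-typings read at print's families -/

section RetypeReadings

variable {x : MemberY d ℓ hd hL b₀ b₁ Mstar}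

/-- at MODULE 3-P's families the R-generic re-typing of a kernel family IS MODULE 5-P's `kernelFamilyP`. [cite: Balaban1985BackgroundPropagators, p.397 (bookkeeping)] -/
theorem kernelFamilyR_regYP (K : B9.KernelFamily (geo9Y x) (bg9Y 𝔸 G x)) :
    kernelFamilyR (regYP335 𝔸 G) (regYP336 𝔸 G) K = B9PinCarriersKLevelV1P.kernelFamilyP K := rfl
/-- at MODULE 3-P's families the R-generic re-typed site kernel IS MODULE 5-P's. [cite: Balaban1985BackgroundPropagators, p.398 (bookkeeping)] -/
theorem siteKernelR_regYP (C : B9.SiteKernel (geo9Y x) (bg9Y 𝔸 G x)) :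
    siteKernelR (regYP335 𝔸 G) (regYP336 𝔸 G) C = B9PinCarriersKLevelV1P.siteKernelP C := rfl
/-- at MODULE 3-P's families the R-generic re-typed `H`-kernel IS MODULE 5-P's. [cite: Balaban1985BackgroundPropagators, p.422 (bookkeeping)] -/
theorem hKernelR_regYP (H : B9.HKernel (geo9Y x) (bg9Y 𝔸 G x)) :
    hKernelR (regYP335 𝔸 G) (regYP336 𝔸 G) H = B9PinCarriersKLevelV1P.hKernelP H := rfl

end RetypeReadings

/-! ## §2 The carrier bundle over the class-parametric carrier as a function of the operator layer; its two readings -/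

variable (d ℓ hd hL b₀ b₁ Mstar 𝔸 G)

/-- **THE [B9] CARRIER BUNDLE OF STAGE 3′(Y) OVER THE CLASS-PARAMETRIC CARRIER, AS A FUNCTION OF THE OPERATOR LAYER**: MODULE 5-P's `carriersYP` with
`bg9 := bg9YR 𝔸 G R₁ R₂`, the operator records re-typed fieldwise (§1), everything else verbatim.
[cite: Balaban1985BackgroundPropagators, p.396 ((3.35)–(3.38), the cube class as a parameter), Thms 3.1–3.15 pp.397–432 (the carriers of the typed statements)] -/
def carriersYR (R₁ R₂ : RegFamY d ℓ hd hL b₀ b₁ Mstar 𝔸) (ops : ∀ x : MemberY d ℓ hd hL b₀ b₁ Mstar, OperatorLayerY d ℓ hd hL b₀ b₁ Mstar 𝔸 G x) :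
    PrintedCarriers9X where
  I9 := MemberY d ℓ hd hL b₀ b₁ Mstar
  d9 := d + 1
  c35 := c35Y
  geo9 := geo9Y
  bg9 := bg9YR 𝔸 G R₁ R₂
  InCube := InCubeY
  Gp := fun x => kernelFamilyR R₁ R₂ (ops x).Gp
  GA := fun x => kernelFamilyR R₁ R₂ (ops x).GA
  Cinv := fun x => siteKernelR R₁ R₂ (ops x).Cinv
  IsAnalyticExt := fun x K => (ops x).IsAnalyticExt (kernelFamilyRY K)
  E37 := fun x => rwExpansionR R₁ R₂ (ops x).E37
  EK39 := fun x => rwKernelExpansionR R₁ R₂ (ops x).EK39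
  E310 := fun x => rwExpansionR R₁ R₂ (ops x).E310
  PosDef := fun x => (ops x).PosDef
  GD := fun x => kernelFamilyR R₁ R₂ (ops x).GD
  G₁ := fun x => kernelFamilyR R₁ R₂ (ops x).G₁
  H := fun x => hKernelR R₁ R₂ (ops x).H
  H₁ := fun x => hKernelR R₁ R₂ (ops x).H₁
  HasRWExp := fun x K => (ops x).HasRWExp (kernelFamilyRY K)
  HasRWExpH := fun x K => (ops x).HasRWExpH (hKernelRY K)
  PosDefK := fun x K => (ops x).PosDefK (kernelFamilyRY K)
  GG := fun x => kernelFamilyR R₁ R₂ (ops x).GG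
  Kdiff := fun x => kernelFamilyR R₁ R₂ (ops x).Kdiff
  dOmega := dOmegaY
  Ck := fun x => siteKernelR R₁ R₂ (ops x).Ck
  inΛ := inΛY
  unitDist := unitDistY
  GivenBy3185 := fun x => (ops x).GivenBy3185
  HasRWExpC := fun x => (ops x).HasRWExpC
  P349 := fun x => fineKernelR R₁ R₂ (ops x).P349
  QGQinv := fun x => siteKernelR R₁ R₂ (ops x).QGQinv
  QG1Qinv := fun x => siteKernelR R₁ R₂ (ops x).QG1Qinv
  OmK := OmKY

variable {d ℓ hd hL b₀ b₁ Mstar 𝔸 G}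
variable (R₁ R₂ : RegFamY d ℓ hd hL b₀ b₁ Mstar 𝔸) (ops : ∀ x : MemberY d ℓ hd hL b₀ b₁ Mstar, OperatorLayerY d ℓ hd hL b₀ b₁ Mstar 𝔸 G x)

/-- the index of the bundle is the member type. [cite: Balaban1985BackgroundPropagators, p.399 (bookkeeping)] -/
theorem carriersYR_I9 : (carriersYR d ℓ hd hL b₀ b₁ Mstar 𝔸 G R₁ R₂ ops).I9 = MemberY d ℓ hd hL b₀ b₁ Mstar := rfl
/-- the geometry of the bundle is `geo9Y`. [cite: Balaban1985BackgroundPropagators, Sect. A pp.396–397 (bookkeeping)] -/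
theorem carriersYR_geo9 : (carriersYR d ℓ hd hL b₀ b₁ Mstar 𝔸 G R₁ R₂ ops).geo9 = geo9Y := rfl
/-- **the backgrounds of the bundle are `bg9YR R₁ R₂`**. [cite: Balaban1985BackgroundPropagators, (3.35)–(3.38) p.396 (bookkeeping)] -/
theorem carriersYR_bg9 : (carriersYR d ℓ hd hL b₀ b₁ Mstar 𝔸 G R₁ R₂ ops).bg9 = bg9YR 𝔸 G R₁ R₂ := rfl
/-- the threshold of (3.35) at the bundle is `10` = print's «a number ≧ 10». [cite: Balaban1985BackgroundPropagators, p.396 («≧ 10»)] -/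
theorem carriersYR_c35 : (carriersYR d ℓ hd hL b₀ b₁ Mstar 𝔸 G R₁ R₂ ops).c35 = 10 := rfl
/-- (3.154) at the bundle is `dOmegaY`. [cite: Balaban1985BackgroundPropagators, (3.154) p.427 (bookkeeping)] -/
theorem carriersYR_dOmega : (carriersYR d ℓ hd hL b₀ b₁ Mstar 𝔸 G R₁ R₂ ops).dOmega = dOmegaY := rfl
/-- Cor. 3.6's cube predicate at the bundle is `InCubeY`. [cite: Balaban1985BackgroundPropagators, Cor. 3.6 p.408 (bookkeeping)] -/
theorem carriersYR_InCube : (carriersYR d ℓ hd hL b₀ b₁ Mstar 𝔸 G R₁ R₂ ops).InCube = InCubeY := rfl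
/-- the kernel entries of `G′` at the bundle are the operator layer's. [cite: Balaban1985BackgroundPropagators, (3.42) p.397 (bookkeeping)] -/
theorem carriersYR_Gp_e (x : MemberY d ℓ hd hL b₀ b₁ Mstar) : ((carriersYR d ℓ hd hL b₀ b₁ Mstar 𝔸 G R₁ R₂ ops).Gp x).e = (ops x).Gp.e := rfl
/-- the kernel entries of `G` at the bundle are the operator layer's. [cite: Balaban1985BackgroundPropagators, (3.42) p.397 (bookkeeping)] -/
theorem carriersYR_GA_e (x : MemberY d ℓ hd hL b₀ b₁ Mstar) : ((carriersYR d ℓ hd hL b₀ b₁ Mstar 𝔸 G R₁ R₂ ops).GA x).e = (ops x).GA.e := rfl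
/-- the kernel of `(Q′G′²Q′*)⁻¹` at the bundle is the operator layer's. [cite: Balaban1985BackgroundPropagators, (3.48) p.398 (bookkeeping)] -/
theorem carriersYR_Cinv_ker (x : MemberY d ℓ hd hL b₀ b₁ Mstar) : ((carriersYR d ℓ hd hL b₀ b₁ Mstar 𝔸 G R₁ R₂ ops).Cinv x).ker = (ops x).Cinv.ker := rfl

/-- **MODULE 5's bundle IS the class-parametric bundle at MODULE 3's families** (definitionally: `bg9Y = bg9YR regY335 regY336` and structure eta on the records).
[cite: Balaban1985BackgroundPropagators, (3.35)–(3.38) p.396, Thms 3.1–3.15 pp.397–432 (bookkeeping: one carrier, two readings of the class)] -/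
theorem carriersY_eq_carriersYR :
    carriersY d ℓ hd hL b₀ b₁ Mstar 𝔸 G ops = carriersYR d ℓ hd hL b₀ b₁ Mstar 𝔸 G (regY335 𝔸 G) (regY336 𝔸 G) ops := rfl

/-- **MODULE 5-P's bundle (print's class) IS the class-parametric bundle at MODULE 3-P's families** (definitionally).
[cite: Balaban1985BackgroundPropagators, (3.35)–(3.38) p.396 («≧ 10»), Thms 3.1–3.15 pp.397–432 (bookkeeping)] -/
theorem carriersYP_eq_carriersYR :
    carriersYP d ℓ hd hL b₀ b₁ Mstar 𝔸 G ops = carriersYR d ℓ hd hL b₀ b₁ Mstar 𝔸 G (regYP335 𝔸 G) (regYP336 𝔸 G) ops := rfl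

/-- hence the N06 target at MODULE 5's bundle IS the target at the class-parametric bundle read at MODULE 3's families.
[cite: Balaban1985BackgroundPropagators, Thms 3.1–3.15 pp.397–432 (bookkeeping)] -/
theorem b9LeafX_carriersY_iff :
    B9LeafX (carriersYR d ℓ hd hL b₀ b₁ Mstar 𝔸 G (regY335 𝔸 G) (regY336 𝔸 G) ops) ↔ B9LeafX (carriersY d ℓ hd hL b₀ b₁ Mstar 𝔸 G ops) := Iff.rfl

/-- hence the N06 target at MODULE 5-P's bundle (print's class) IS the target at the class-parametric bundle read at MODULE 3-P's families.
[cite: Balaban1985BackgroundPropagators, Thms 3.1–3.15 pp.397–432 («≧ 10»; bookkeeping)] -/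
theorem b9LeafX_carriersYP_iff :
    B9LeafX (carriersYR d ℓ hd hL b₀ b₁ Mstar 𝔸 G (regYP335 𝔸 G) (regYP336 𝔸 G) ops) ↔ B9LeafX (carriersYP d ℓ hd hL b₀ b₁ Mstar 𝔸 G ops) := Iff.rfl

/-! ## §3 The N06 knit at the class-parametric bundle: geometric hypotheses discharged, the `U ≡ 1` membership displayed -/

section Knit

/-- **`B6BlockParam (towerBlockOfRecord …) → B9LeafX (carriersYR … R₁ R₂ ops)` — the N06 knit AT THE STAGE-3′(Y) BUNDLE OVER THE CLASS-PARAMETRIC CARRIER** with the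
geometric inputs discharged (`hd := rfl`, `hc := c35Y_pos`, `S :=` dag-n03-b's `modelSignsOn_geo9K`, `Dict := dictAtOneY`) and — the class being a parameter — the
`U ≡ 1` membership `hone` DISPLAYED (at the two readings: `regY335_one x c35Y_pos`, `regYP335_one x c35Y`).  Displayed further: the `U = 1` operator comparisons against
NODE 00's readings (eight per member) and the two null readings — VERBATIM MODULE 5's —, the residual entries, the Sect. B step, the gauge reduction, the sixteen
whole-statement leaves OVER `bg9YR 𝔸 G R₁ R₂` (their (3.35) is the parameter `R₁`), the [B6] block.
[cite: Balaban1985BackgroundPropagators, Thms 3.1–3.15 pp.397–432; Cor. 3.5 proof p.407; p.396 (the class as a parameter)] -/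
theorem b9LeafX_carriersYR (δ₀ : ℝ) {Jt Kt : Type} (tree : Jt → B6.TreeData) (loc : Kt → B6.LocalOp)
    (hone : ∀ (x : MemberY d ℓ hd hL b₀ b₁ Mstar) (α₀ : ℝ), 0 < α₀ → R₁ x c35Y α₀ (bg9YR 𝔸 G R₁ R₂ x).one)
    (hGp_e : ∀ (x : MemberY d ℓ hd hL b₀ b₁ Mstar) (n : Fin 4) (lam : (geo9Y x).Loc) (y : (geo9Y x).Site),
      (ops x).Gp.e n (bg9Y 𝔸 G x).one lam y ≤ (Node00.GpU x.toKIdx).e n lam y)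
    (hGp_h1 : ∀ (x : MemberY d ℓ hd hL b₀ b₁ Mstar) (lam : (geo9Y x).Loc) (b : ℝ) (ζ : (geo9Y x).Cut),
      (ops x).Gp.h1 (bg9Y 𝔸 G x).one lam b ζ ≤ (Node00.GpU x.toKIdx).h1 lam b ζ)
    (hC : ∀ (x : MemberY d ℓ hd hL b₀ b₁ Mstar) (y y' : (geo9Y x).Site), |(ops x).Cinv.ker (bg9Y 𝔸 G x).one y y'| ≤ |(Node00.CinvU x.toKIdx).ker y y'|)
    (hGA_e : ∀ (x : MemberY d ℓ hd hL b₀ b₁ Mstar) (n : Fin 4) (lam : (geo9Y x).Loc) (y : (geo9Y x).Site),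
      (ops x).GA.e n (bg9Y 𝔸 G x).one lam y ≤ (Node00.GU x.toKIdx).e n lam y)
    (hGA_h1 : ∀ (x : MemberY d ℓ hd hL b₀ b₁ Mstar) (lam : (geo9Y x).Loc) (b : ℝ) (ζ : (geo9Y x).Cut),
      (ops x).GA.h1 (bg9Y 𝔸 G x).one lam b ζ ≤ (Node00.GU x.toKIdx).h1 lam b ζ)
    (hGA_e4 : ∀ (x : MemberY d ℓ hd hL b₀ b₁ Mstar) (lam : (geo9Y x).Loc) (y : (geo9Y x).Site),
      (ops x).GA.e4 (bg9Y 𝔸 G x).one lam y ≤ (Node00.GU x.toKIdx).e4 lam y)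
    (hGA_h2 : ∀ (x : MemberY d ℓ hd hL b₀ b₁ Mstar) (lam : (geo9Y x).Loc) (b : ℝ) (ζ : (geo9Y x).Cut),
      (ops x).GA.h2 (bg9Y 𝔸 G x).one lam b ζ ≤ (Node00.GU x.toKIdx).h2 lam b ζ)
    (hGA_l2 : ∀ (x : MemberY d ℓ hd hL b₀ b₁ Mstar) (n : Fin 6) (lam : (geo9Y x).Loc) (h : (geo9Y x).Cut),
      (ops x).GA.l2 n (bg9Y 𝔸 G x).one lam h ≤ (Node00.GU x.toKIdx).l2 n lam h)
    (hE4 : ∀ (x : MemberY d ℓ hd hL b₀ b₁ Mstar) (lam : (geo9Y x).Loc), ¬ (lam.isRight = true) → ∀ y, (ops x).GA.e4 (bg9Y 𝔸 G x).one lam y ≤ 0)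
    (hH2 : ∀ (x : MemberY d ℓ hd hL b₀ b₁ Mstar) (lam : (geo9Y x).Loc), ¬ (lam.isRight = true) →
      ∀ (β : ℝ) (ζ : (geo9Y x).Cut), (ops x).GA.h2 (bg9Y 𝔸 G x).one lam β ζ ≤ 0)
    (hGp : B9FromB6.ResidualGpAtOne geo9Y (bg9YR 𝔸 G R₁ R₂) (fun x => kernelFamilyR R₁ R₂ (ops x).Gp))
    (hGA : B9FromB6.ResidualGAGlobAtOne geo9Y (bg9YR 𝔸 G R₁ R₂) (fun x => kernelFamilyR R₁ R₂ (ops x).GA))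
    (hB : B9.SectBStepPrinted (d + 1) c35Y geo9Y (bg9YR 𝔸 G R₁ R₂) (fun x => kernelFamilyR R₁ R₂ (ops x).Gp) (fun x => kernelFamilyR R₁ R₂ (ops x).GA)
      (fun x => siteKernelR R₁ R₂ (ops x).Cinv) (fun x K => (ops x).IsAnalyticExt (kernelFamilyRY K)))
    (hg : B9.GaugeReduction335 (d + 1) c35Y geo9Y (bg9YR 𝔸 G R₁ R₂) InCubeY (fun x => kernelFamilyR R₁ R₂ (ops x).Gp) (fun x => kernelFamilyR R₁ R₂ (ops x).GA)
      (fun x => siteKernelR R₁ R₂ (ops x).Cinv))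
    (t37 : B9.Thm37Printed c35Y geo9Y (bg9YR 𝔸 G R₁ R₂) (fun x => rwExpansionR R₁ R₂ (ops x).E37))
    (c38 : B9.Cor38Printed c35Y geo9Y (bg9YR 𝔸 G R₁ R₂) (fun x => rwExpansionR R₁ R₂ (ops x).E37))
    (t39 : B9.Thm39Printed (d + 1) c35Y geo9Y (bg9YR 𝔸 G R₁ R₂) (fun x => rwKernelExpansionR R₁ R₂ (ops x).EK39))
    (t310 : B9.Thm310Printed c35Y geo9Y (bg9YR 𝔸 G R₁ R₂) (fun x => rwExpansionR R₁ R₂ (ops x).E310))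
    (hsum : B9.RWSumsYieldIneqs geo9Y (bg9YR 𝔸 G R₁ R₂) (fun x => rwExpansionR R₁ R₂ (ops x).E37) (fun x => rwExpansionR R₁ R₂ (ops x).E310)
      (fun x => kernelFamilyR R₁ R₂ (ops x).Gp) (fun x => kernelFamilyR R₁ R₂ (ops x).GA))
    (hksum : B9.RWKernelSumYields (d + 1) geo9Y (bg9YR 𝔸 G R₁ R₂) (fun x => rwKernelExpansionR R₁ R₂ (ops x).EK39) (fun x => siteKernelR R₁ R₂ (ops x).Cinv))
    (t311 : B9.Thm311Printed c35Y geo9Y (bg9YR 𝔸 G R₁ R₂) (fun x => (ops x).PosDef))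
    (t312 : B9.Thm312Printed (d + 1) c35Y geo9Y (bg9YR 𝔸 G R₁ R₂) (fun x => kernelFamilyR R₁ R₂ (ops x).GD) (fun x => kernelFamilyR R₁ R₂ (ops x).G₁)
      (fun x => hKernelR R₁ R₂ (ops x).H) (fun x => hKernelR R₁ R₂ (ops x).H₁) (fun x K => (ops x).HasRWExp (kernelFamilyRY K))
      (fun x K => (ops x).HasRWExpH (hKernelRY K)) (fun x K => (ops x).PosDefK (kernelFamilyRY K)))
    (t313 : B9.Thm313Printed c35Y geo9Y (bg9YR 𝔸 G R₁ R₂) (fun x => kernelFamilyR R₁ R₂ (ops x).GG) (fun x K => (ops x).HasRWExp (kernelFamilyRY K))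
      (fun x K => (ops x).PosDefK (kernelFamilyRY K)))
    (t314 : B9.Thm314Printed c35Y geo9Y (bg9YR 𝔸 G R₁ R₂) (fun x => kernelFamilyR R₁ R₂ (ops x).Kdiff) dOmegaY)
    (t315 : B9.Thm315FullPrinted c35Y geo9Y (bg9YR 𝔸 G R₁ R₂) (fun x => siteKernelR R₁ R₂ (ops x).Ck) inΛY unitDistY (fun x => (ops x).GivenBy3185)
      (fun x => (ops x).HasRWExpC))
    (s349 : B9.Stmt349Printed (d + 1) c35Y geo9Y (bg9YR 𝔸 G R₁ R₂) (fun x => fineKernelR R₁ R₂ (ops x).P349))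
    (s3132 : B9.Stmt3132Printed (d + 1) c35Y geo9Y (bg9YR 𝔸 G R₁ R₂) (fun x => siteKernelR R₁ R₂ (ops x).QGQinv) (fun x => siteKernelR R₁ R₂ (ops x).QG1Qinv))
    (t314loc : B9Thm314.Thm314LocalPrinted c35Y geo9Y (bg9YR 𝔸 G R₁ R₂) (fun x => kernelFamilyR R₁ R₂ (ops x).Kdiff) OmKY dOmegaY)
    (h6 : B6BlockParam (Node00.towerBlockOfRecord d ℓ hd hL b₀ b₁ δ₀ tree loc)) :
    B9LeafX (carriersYR d ℓ hd hL b₀ b₁ Mstar 𝔸 G R₁ R₂ ops) :=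
  B9LeafKnitOn.b9LeafX_of_b6BlockParam_on (carriersYR d ℓ hd hL b₀ b₁ Mstar 𝔸 G R₁ R₂ ops) (Node00.towerBlockOfRecord d ℓ hd hL b₀ b₁ δ₀ tree loc) rfl
    (fun x => ⟨x.toKIdx, x.hcfk⟩)
    (fun x => dictAtOneY x (kernelFamilyR R₁ R₂ (ops x).Gp) (kernelFamilyR R₁ R₂ (ops x).GA) (siteKernelR R₁ R₂ (ops x).Cinv) (hGp_e x) (hGp_h1 x) (hC x) (hGA_e x)
      (hGA_h1 x) (hGA_e4 x) (hGA_h2 x) (hGA_l2 x))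
    (fun _ => fun lam => lam.isRight = true) (fun x => B9GeoNormsKLevelModelSignsV1.modelSignsOn_geo9K x.toKIdx) hE4 hH2 hGp hGA c35Y_pos
    hone hB hg t37 c38 t39 t310 hsum hksum t311 t312 t313 t314 t315 s349 s3132 t314loc h6

end Knit

/-! ## §4 Guards at the bundle -/

/-- the bundle's index is inhabited (odd `L ≥ 5`, band `0 < b₀ ≤ b₁`). [cite: Balaban1985BackgroundPropagators, p.399 (the family is inhabited)] -/
theorem carriersYR_nonempty_I9 (hℓ : 4 ≤ ℓ) (hb₀ : 0 < b₀) (hb₁ : b₀ ≤ b₁) : Nonempty (carriersYR d ℓ hd hL b₀ b₁ Mstar 𝔸 G R₁ R₂ ops).I9 :=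
  B9PinMembersKLevelV1.memberY_nonempty hℓ hb₀ hb₁

/-- `M` is unbounded over the bundle's index. [cite: Balaban1985BackgroundPropagators, Thm 3.1 p.397 («for M ≥ M₁»)] -/
theorem carriersYR_unbounded_M (hℓ : 4 ≤ ℓ) (hb₀ : 0 < b₀) (hb₁ : b₀ ≤ b₁) (M₂ : ℝ) :
    ∃ i : (carriersYR d ℓ hd hL b₀ b₁ Mstar 𝔸 G R₁ R₂ ops).I9, M₂ ≤ ((carriersYR d ℓ hd hL b₀ b₁ Mstar 𝔸 G R₁ R₂ ops).geo9 i).M :=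
  B9PinMembersKLevelV1.memberY_unbounded_M hℓ hb₀ hb₁ M₂

/-- at `L = 5` the bundle has members with non-empty `Λ`. [cite: Balaban1985BackgroundPropagators, Thm 3.15 p.432 (non-vacuity of the typed datum)] -/
theorem carriersYR_exists_nonempty_Λ (hℓ : 4 ≤ ℓ) (hℓ4 : ℓ ≤ 4) {k : ℕ} (hk : 2 ≤ k) (hb₀ : 0 < b₀) (hb₁ : b₀ ≤ b₁) (M₂ : ℝ) :
    ∃ i : (carriersYR d ℓ hd hL b₀ b₁ Mstar 𝔸 G R₁ R₂ ops).I9, i.k = k ∧ M₂ ≤ ((carriersYR d ℓ hd hL b₀ b₁ Mstar 𝔸 G R₁ R₂ ops).geo9 i).M ∧ i.Λ.Nonempty :=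
  B9PinMembersKLevelV1.memberY_exists_nonempty_Λ hℓ hℓ4 hk hb₀ hb₁ M₂

/-- Cor. 3.6 at the bundle is VACUOUS (MODULE 4's located fact `not_inCubeY`), for any operator layer and any class.
[cite: Balaban1985BackgroundPropagators, Cor. 3.6 p.408 (bookkeeping: vacuity at these carriers)] -/
theorem carriersYR_cor36_vacuous :
    B9.Cor36Printed (d + 1) c35Y geo9Y (bg9YR 𝔸 G R₁ R₂) InCubeY (fun x => kernelFamilyR R₁ R₂ (ops x).Gp) (fun x => kernelFamilyR R₁ R₂ (ops x).GA)
      (fun x => siteKernelR R₁ R₂ (ops x).Cinv) :=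
  B9PinGeometryKLevelV1.cor36Printed_vacuous (d + 1) c35Y (bg9YR 𝔸 G R₁ R₂) _ _ _

end Literature.MathematicalPhysics.QuantumFieldTheory.Balaban1983to89.B9PinCarriersKLevelV1R

end
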